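import Summits.QuantumFields.BalabanUV.Beta.FP.StepLawAssembly
import Summits.QuantumFields.BalabanUV.Beta.FP.SymmetryInheritHolds
import Summits.QuantumFields.BalabanUV.Beta.FP.KSlotHolds

/-!
# `BalabanUV.Beta.FP.StepLawFromRows` — road «FP» for binder row D1, the (STEP) socket FED BY THE WALL's SYMMETRY ROWS: leaf-02's `fPerf_succ_of_fubini_flip`
# (v1.1 of `FP/StepLawAssembly`) with its two printed-law binders `WardTransversal (flipK (TPerf 1))` / `AxisReflectionCovariant (flipK (TPerf 1))` DISCHARGED
# from the finite-`j` rows `hW` (an1) / `hR` (an2) of the wall family + the S- and W-slot Cauchy rows, by `FP.SymmetryInheritHolds` (`d = 3`, `2 ≤ Lc`, adopted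
# units; K-rows from gan24's `convCKWall_holds`), and its bond-unit pin by `KSlotHolds.sfStep_mul_smStep_three` — BY NAME

HONEST FRAMING (cell contract, verbatim): «discharging `BetaPertH` makes Bałaban's UV stability UNCONDITIONAL — a real constructive-QFT result; it is NOT the
continuum limit and NOT the Clay problem.»  THIS MODULE DISCHARGES NOTHING of the wall: EVERY analytic input stays a HYPOTHESIS, displayed — per `m`: X1m-K (`hK`,
`hKall`, `θ m < 1`) and the limit-currency class data of the perfect triples; at `m = 1`: the S- and W-slot rows and the `m = 1` pins; the rows `hRj` / `hWj` (two of the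
four binders of `OneStepKernelFamily.d1Drift_of_D1Tel_D1Rep`); the fixed-point Fubini identity with remainder (N2a), AbsMoment₂ of the defect and (SDF)∞ (N2b).
HEADLINE: «the perfect family's STEP LAW from {X1m, class data, S/W slots, hR, hW, Fubini∞, (SDF)∞}» — NOT «(STEP) proved», NOT «D1 closed», NOT G-an2-4, NOT
BetaPertH, NOT continuum, NOT Clay; 0 wall binders instantiated.  Claim table `HOME/b2b-balaban-beta-d1-p3/LEAVES-FP.md` sub-row N2-asm (leaf-02) — this is a
COMPOSITION over it (unit `b2b-balaban-beta-d1-formalise-leaf-06`), nothing of leaf-02's restated.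
ABSOLUTE RULE (cell, verbatim): «No internally-minted statement may enter as a cited fact. Every hypothesis is either kernel-proved in this package or a verbatim
quotation of a PUBLISHED theorem with page reference.»  Nothing is cited; no `def … : Prop`.
-/

namespace Summit.QuantumFields.BalabanUV.Beta.FP.StepLawFromRows

open Filter Topology
open Literature.MathematicalPhysics.QuantumFieldTheory.Balaban1983to89
open Literature.MathematicalPhysics.QuantumFieldTheory.Balaban1983to89.Beta
open B12Beta (secondMoment)
open DecimatedMomentSummable (AbsMoment₂)
open DressedMomentNormalisation (EKer dressedEntry)
open ExpKernelCalculus (MKer Decays VertexFamily₂)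
open PolarizationSign (WardTransversal AxisReflectionCovariant)
open OneStepResolventKernel (Fib LocStencil)
open OneStepKernelFamily (KInvStep TbalOf flipK)
open BalabanStepJetsSucc (JsBal0Of JsBalOf)
open Summit.QuantumFields.BalabanUV.Beta.HessKerDressedUnits (unitK unitS unitW)
open Summit.QuantumFields.BalabanUV.Beta.GAN24.CombesThomas (sfStep smStep)
open Summit.QuantumFields.BalabanUV.Beta.FP.PerfectObjects (KTot)
open Summit.QuantumFields.BalabanUV.Beta.FP.PerfectObjectsT (KPerf SPerfOf WPerfOf TPerfOf fPerf)
open Summit.QuantumFields.BalabanUV.Beta.FP.TransportInfinityM (colOf)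
open Summit.QuantumFields.BalabanUV.Beta.FP.StepLawAssembly (fPerf_succ_of_fubini_flip)
open Summit.QuantumFields.BalabanUV.Beta.FP.SymmetryInheritHolds (axisReflectionCovariant_flipK_TPerfOf_one_holdsK wardTransversal_flipK_TPerfOf_one_holdsK)
open Summit.QuantumFields.BalabanUV.Beta.FP.KSlotHolds (sfStep_mul_smStep_three)

noncomputable section

variable {Lc : ℕ} [NeZero Lc] (hLc : 1 ≤ Lc) (cE cVH cΛ : ℝ)
  (W : ℕ → Fin (3 + 1) → (Fin (3 + 1) → ℤ) → Fin (3 + 1) → (Fin (3 + 1) → ℤ) → MKer (3 + 1) (Fib 3))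
  (Cw' δw : ℕ → ℝ) (hδw : ∀ j, 0 < δw j) (hW' : ∀ j, VertexFamily₂ (W j) Lc (Cw' j) (δw j))
  (S : ℕ → ℕ → Fin (3 + 1) → (Fin (3 + 1) → ℤ) → MKer (3 + 1) (Fib 3))
  (Wt : ℕ → ℕ → Fin (3 + 1) → (Fin (3 + 1) → ℤ) → Fin (3 + 1) → (Fin (3 + 1) → ℤ) → MKer (3 + 1) (Fib 3))
  {Cs cS δS θS Cw cW δW θW : ℝ} {D : ℕ → EKer 4} {C δK c δ θ CK δK' Cs' δS' Cw'' δW' : ℕ → ℝ}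

/-- **THE STEP LAW OF THE PERFECT COEFFICIENT FAMILY FROM THE WALL's ROWS** (`d = 3`, `2 ≤ Lc`, adopted units `(sfStep Lc, smStep 3 Lc)`): leaf-02's
`fPerf_succ_of_fubini_flip` with (i) `hunit` := `sfStep_mul_smStep_three`, (ii) `hWf` := `wardTransversal_flipK_TPerfOf_one_holdsK … hWj`, (iii) `hRf` :=
`axisReflectionCovariant_flipK_TPerfOf_one_holdsK … hRj`.  CONCLUSION: `∀ m ≥ 1, fPerf … (m+1) = fPerf … m + fPerf … 1` — the `hstep` of
`RoadFromSlots.d1Drift_JsBalOf_of_slots_step_law_bounded`.  Every binder displayed; discharges nothing by itself. [our object] -/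
theorem fPerf_succ_of_rows (hLc2 : 2 ≤ Lc)
    -- the `m = 1` pins and the S- and W-slot Cauchy rows (row G-an2-4, adopted units)
    (hS1 : ∀ j, S j 1 = (JsBal0Of hLc cE cVH cΛ W Cw' δw hδw hW' j).S) (hW1 : ∀ j, Wt j 1 = W j)
    (hS : ∀ j, LocStencil (unitS (sfStep Lc j) (smStep 3 Lc j) (JsBal0Of hLc cE cVH cΛ W Cw' δw hδw hW' j).S) Cs δS)
    (hSall : ∀ k j, LocStencil (unitS (sfStep Lc (k + j)) (smStep 3 Lc (k + j)) (JsBal0Of hLc cE cVH cΛ W Cw' δw hδw hW' (k + j)).S -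
      unitS (sfStep Lc k) (smStep 3 Lc k) (JsBal0Of hLc cE cVH cΛ W Cw' δw hδw hW' k).S) (cS * θS ^ k) δS)
    (hW : ∀ j, VertexFamily₂ (unitW (sfStep Lc j) (smStep 3 Lc j) (W j)) Lc Cw δW)
    (hWall : ∀ k j, VertexFamily₂ (unitW (sfStep Lc (k + j)) (smStep 3 Lc (k + j)) (W (k + j)) - unitW (sfStep Lc k) (smStep 3 Lc k) (W k)) Lc
      (cW * θW ^ k) δW)
    (hδS : 0 < δS) (hδW : 0 < δW) (hθS0 : 0 ≤ θS) (hθS1 : θS < 1) (hθW0 : 0 ≤ θW) (hθW1 : θW < 1)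
    -- the finite-`j` symmetry rows of the wall family (an2's hR, an1's hW)
    (hRj : ∀ j, AxisReflectionCovariant (flipK (TbalOf Lc (JsBalOf hLc cE cVH cΛ W Cw' δw hδw hW') j)))
    (hWj : ∀ j, WardTransversal (flipK (TbalOf Lc (JsBalOf hLc cE cVH cΛ W Cw' δw hδw hW') j)))
    -- per-`m` X1m-K and the limit-currency class data of the perfect triples
    (hC : ∀ m, 0 ≤ C m) (hδK : ∀ m, 0 < δK m)
    (hK : ∀ m j, Decays (unitK (sfStep Lc j) (smStep 3 Lc j) (KTot (d := 3) (Lc ^ (j + m)) (Lc ^ j))) (C m) (δK m))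
    (hKall : ∀ m k j, Decays (unitK (sfStep Lc (k + j)) (smStep 3 Lc (k + j)) (KTot (d := 3) (Lc ^ (k + j + m)) (Lc ^ (k + j)))
      - unitK (sfStep Lc k) (smStep 3 Lc k) (KTot (d := 3) (Lc ^ (k + m)) (Lc ^ k))) (c m * θ m ^ k) (δ m)) (hθ1 : ∀ m, θ m < 1)
    (hKinf : ∀ m : ℕ, 1 ≤ m → Decays (KPerf (d := 3) Lc (sfStep Lc) (smStep 3 Lc) m) (CK m) (δK' m)) (hδK' : ∀ m, 0 < δK' m)
    (hSinf : ∀ m : ℕ, 1 ≤ m → LocStencil (SPerfOf (sfStep Lc) (smStep 3 Lc) S m) (Cs' m) (δS' m)) (hδS' : ∀ m, 0 < δS' m)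
    (hWinf : ∀ m : ℕ, 1 ≤ m → VertexFamily₂ (WPerfOf (sfStep Lc) (smStep 3 Lc) Wt m) (Lc ^ m) (Cw'' m) (δW' m)) (hδW' : ∀ m, 0 < δW' m)
    -- N2a (Fubini∞ with remainder `D`), N2b ((SDF)∞)
    (hDA : ∀ m : ℕ, 1 ≤ m → ∀ a b, AbsMoment₂ (D m a b))
    (hfub : ∀ m : ℕ, 1 ≤ m → ∀ (a b : Fin 4) (z : Fin 4 → ℤ),
      TPerfOf (Lc ^ (m + 1)) (KPerf Lc (sfStep Lc) (smStep 3 Lc) (m + 1)) (SPerfOf (sfStep Lc) (smStep 3 Lc) S (m + 1))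
          (WPerfOf (sfStep Lc) (smStep 3 Lc) Wt (m + 1)) a b z
        = ((Lc ^ m : ℕ) : ℝ) ^ 8 * dressedEntry (colOf (KPerf (d := 3) Lc (sfStep Lc) (smStep 3 Lc) m))
            (TPerfOf Lc (KPerf Lc (sfStep Lc) (smStep 3 Lc) 1) (SPerfOf (sfStep Lc) (smStep 3 Lc) S 1) (WPerfOf (sfStep Lc) (smStep 3 Lc) Wt 1))
            (((Lc ^ m : ℕ) : ℤ) • z) a b
          + TPerfOf (Lc ^ m) (KPerf Lc (sfStep Lc) (smStep 3 Lc) m) (SPerfOf (sfStep Lc) (smStep 3 Lc) S m) (WPerfOf (sfStep Lc) (smStep 3 Lc) Wt m) a b z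
          + D m a b z)
    (μ ν : Fin 4) (hSDF : ∀ m : ℕ, 1 ≤ m → secondMoment (D m) μ ν = 0) :
    ∀ m : ℕ, 1 ≤ m → fPerf Lc (sfStep Lc) (smStep 3 Lc) S Wt μ ν (m + 1) =
      fPerf Lc (sfStep Lc) (smStep 3 Lc) S Wt μ ν m + fPerf Lc (sfStep Lc) (smStep 3 Lc) S Wt μ ν 1 :=
  fPerf_succ_of_fubini_flip (sfStep_mul_smStep_three Lc) S Wt hC hδK hK hKall hθ1 hKinf hδK' hSinf hδS' hWinf hδW'
    (wardTransversal_flipK_TPerfOf_one_holdsK hLc cE cVH cΛ W Cw' δw hδw hW' S Wt hLc2 hS1 hW1 hS hSall hW hWall hδS hδW hθS0 hθS1 hθW0 hθW1 hWj)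
    (axisReflectionCovariant_flipK_TPerfOf_one_holdsK hLc cE cVH cΛ W Cw' δw hδw hW' S Wt hLc2 hS1 hW1 hS hSall hW hWall hδS hδW hθS0 hθS1 hθW0 hθW1
      hRj)
    hDA hfub μ ν hSDF

end

end Summit.QuantumFields.BalabanUV.Beta.FP.StepLawFromRows
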